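import Mathlib
import Literature.NumberTheory.Transcendental.ZagierDilogarithmConjecture
import Literature.NumberTheory.Transcendental.BlochWignerDilogarithm
import Summits.KontsevichZagierPeriods.KontsevichZagierPeriods.Theorems.HyperbolicBlochZagierDilogarithmConjectureStubCyclotomicIndependence
import Summits.KontsevichZagierPeriods.KontsevichZagierPeriods.Theorems.HyperbolicBlochZagierDilogarithmConjectureStubClausenCharSumPrimitive
import HarnessLib

/-!
# `ZagierDilogarithmConjecture` (stmt-KontsevichZagierPeriods-10550) — line
`kummer-clausen-linearisation` (reshape c4, "the cyclotomic sector, exactly"), stub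
`stub_cyclotomicPrimeSector_iff`

**The prime cyclotomic sector of Zagier's conjecture is EQUIVALENT to Milnor's conjecture.** Let `p` be
a prime, `ζ_p = e^{2πi/p}`, `D` the Bloch–Wigner dilogarithm (`blochWignerDilog`) and `⟨dilogRelators⟩`
the relator group of Zagier's dilogarithm conjecture (Neumann 1998, §2.1). Then the following are
equivalent:

* (crux on `μ_p ∩ ℍ⁺`) every `ℤ`-relation `Σᵢ nᵢ D(uᵢ) = 0` among `p`-th roots of unity `uᵢ` of the
  open upper half plane is explained: `Σᵢ nᵢ [uᵢ] ∈ ⟨dilogRelators⟩`;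
* (Milnor's conjecture for `p`, `ℤ`-form) the Clausen values `D(ζ_p^c)`, `0 < c < p/2`, admit only the
  trivial `ℤ`-relation (Milnor 1982, Appendix).

Proof. `⇒`: given `m : ℤ/p → ℤ` supported on `0 < c < p/2` with `Σ_c m_c D(ζ_p^c) = 0`, index the
support `S = {c | m_c ≠ 0} ≃ Fin k` and feed the family `uᵢ = ζ_p^{cᵢ}` (a `p`-th root of unity with
`Im = sin(2πcᵢ/p) > 0`) to the crux: `Σ_c m_c [ζ_p^c] ∈ ⟨dilogRelators⟩`. For a prime `p` every residue
`0 < c < p/2` is a unit, so the landed UNCONDITIONAL cyclotomic independence theorem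
`stub_cyclotomicIndependence` forces `m = 0`. `⇐`: a `p`-th root of unity `u` in `ℍ⁺` is `ζ_p^j` with
`0 ≤ j < p` (`IsPrimitiveRoot.eq_pow_of_pow_eq_one`), and `Im ζ_p^j = sin(2πj/p) > 0` forces `0 < j`
and `2j < p` (for `p ≤ 2j < 2p` the sine is `≤ 0`). Group a family `(uᵢ, nᵢ)` by the exponent:
`M_c = Σ_{i : cᵢ = c} nᵢ`; then `Σ_c M_c D(ζ_p^c) = Σᵢ nᵢ D(uᵢ) = 0` with `M` supported on
`0 < c < p/2`, so Milnor gives `M = 0`, and `Σᵢ nᵢ [uᵢ] = Σ_c M_c [ζ_p^c] = 0 ∈ ⟨dilogRelators⟩`.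
Sorry-free; axioms ⊆ {propext, Classical.choice, Quot.sound}.

## References

* W. D. Neumann, *Hilbert's 3rd problem and invariants of 3-manifolds*, Geom. Topol. Monogr. 1 (1998),
  §2.1. [Neumann1998]
* J. Milnor, *Hyperbolic geometry: the first 150 years*, Bull. AMS 6 (1982), Appendix (the conjecture
  on the values `Л(πc/N)`). [Milnor1982]
-/

noncomputable section

open scoped BigOperators ComplexConjugate
open Literature.NumberTheory.Transcendental

namespace Summit.KontsevichZagierPeriods.HyperbolicBloch.ZagierDilogarithmCyclotomic

/-! ### Roots of unity in the upper half plane -/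

namespace CyclotomicPrimeSector

/-- `Im ζ_N^c = sin(2πc/N)`. [folklore] -/
theorem zeta_pow_im (N c : ℕ) :
    (Complex.exp (2 * Real.pi * Complex.I / N) ^ c).im = Real.sin (2 * Real.pi * c / N) := by
  rw [cexp_two_pi_div_pow, Complex.exp_ofReal_mul_I_im]

/-- `ζ_N^c` lies in the open upper half plane when `0 < c < N/2`. [folklore] -/
theorem zeta_pow_im_pos (N : ℕ) [NeZero N] {c : ℕ} (hc0 : 0 < c) (hc2 : 2 * c < N) :
    0 < (Complex.exp (2 * Real.pi * Complex.I / N) ^ c).im := by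
  rw [zeta_pow_im]
  have hN : (0 : ℝ) < N := by exact_mod_cast NeZero.pos N
  refine Real.sin_pos_of_pos_of_lt_pi (by positivity) ?_
  rw [div_lt_iff₀ hN]
  have h : (2 * c : ℝ) < N := by exact_mod_cast hc2
  nlinarith [Real.pi_pos]

/-- `ζ_N^c` does NOT lie in the open upper half plane when `N/2 ≤ c ≤ N`. [folklore] -/
theorem zeta_pow_im_nonpos (N : ℕ) [NeZero N] {c : ℕ} (hc1 : N ≤ 2 * c) (hc2 : c ≤ N) :
    (Complex.exp (2 * Real.pi * Complex.I / N) ^ c).im ≤ 0 := by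
  rw [zeta_pow_im, ← Real.sin_sub_two_pi]
  have hN : (0 : ℝ) < N := by exact_mod_cast NeZero.pos N
  have h1 : (N : ℝ) ≤ 2 * c := by exact_mod_cast hc1
  have h2 : (c : ℝ) ≤ N := by exact_mod_cast hc2
  have hle : 2 * Real.pi * c / N ≤ 2 * Real.pi := by
    rw [div_le_iff₀ hN]
    nlinarith [Real.pi_pos]
  have hge : Real.pi ≤ 2 * Real.pi * c / N := by
    rw [le_div_iff₀ hN]
    nlinarith [Real.pi_pos]
  exact Real.sin_nonpos_of_nonpos_of_neg_pi_le (by linarith) (by linarith)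

/-- An `N`-th root of unity of the open upper half plane is `ζ_N^c` for a residue `c mod N` with
`0 < c < N/2`. [folklore] -/
theorem exists_eq_zeta_pow (N : ℕ) [NeZero N] {u : ℂ} (hu : u ^ N = 1) (him : 0 < u.im) :
    ∃ c : ZMod N, 0 < c.val ∧ 2 * c.val < N ∧
      u = Complex.exp (2 * Real.pi * Complex.I / N) ^ c.val := by
  obtain ⟨j, hj, hju⟩ :=
    (Complex.isPrimitiveRoot_exp N (NeZero.ne N)).eq_pow_of_pow_eq_one hu
  refine ⟨(j : ZMod N), ?_⟩
  rw [ZMod.val_cast_of_lt hj]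
  refine ⟨?_, ?_, hju.symm⟩
  · rcases Nat.eq_zero_or_pos j with rfl | h
    · rw [pow_zero] at hju
      rw [← hju, Complex.one_im] at him
      exact absurd him (lt_irrefl 0)
    · exact h
  · by_contra h
    have h' := zeta_pow_im_nonpos N (not_lt.1 h) hj.le
    rw [hju] at h'
    exact absurd him (not_lt.2 h')

/-! ### Grouping a family by the fibres of an index map -/

/-- `Σ_d (Σ_{i : c i = d} nᵢ) · F(d) = Σᵢ nᵢ · F(c i)` (real values). [folklore] -/
theorem sum_fiber_mul {ι κ : Type*} [Fintype ι] [Fintype κ] [DecidableEq κ] (c : ι → κ)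
    (n : ι → ℤ) (F : κ → ℝ) :
    ∑ d, ((∑ i ∈ Finset.univ.filter (fun i => c i = d), n i : ℤ) : ℝ) * F d =
      ∑ i, (n i : ℝ) * F (c i) := by
  rw [← Finset.sum_fiberwise Finset.univ c (fun i => (n i : ℝ) * F (c i))]
  refine Finset.sum_congr rfl fun d _ => ?_
  rw [Int.cast_sum, Finset.sum_mul]
  refine Finset.sum_congr rfl fun i hi => ?_
  rw [(Finset.mem_filter.1 hi).2]

/-- `Σ_d (Σ_{i : c i = d} nᵢ) • F(d) = Σᵢ nᵢ • F(c i)` (values in an abelian group). [folklore] -/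
theorem sum_fiber_zsmul {ι κ G : Type*} [Fintype ι] [Fintype κ] [DecidableEq κ] [AddCommGroup G]
    (c : ι → κ) (n : ι → ℤ) (F : κ → G) :
    ∑ d, (∑ i ∈ Finset.univ.filter (fun i => c i = d), n i) • F d = ∑ i, n i • F (c i) := by
  rw [← Finset.sum_fiberwise Finset.univ c (fun i => n i • F (c i))]
  refine Finset.sum_congr rfl fun d _ => ?_
  rw [Finset.sum_smul]
  refine Finset.sum_congr rfl fun i hi => ?_
  rw [(Finset.mem_filter.1 hi).2]

end CyclotomicPrimeSector

open CyclotomicPrimeSector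

/-! ### The equivalence -/

/-- **Stub `stub_cyclotomicPrimeSector_iff`: the prime cyclotomic sector of the crux is EQUIVALENT to
Milnor's conjecture.** For a prime `p`, Zagier's conjecture restricted to `p`-th roots of unity (every
`ℤ`-relation among the `D`-values of points of `μ_p ∩ ℍ⁺` is explained) holds if and only if the
Clausen values `D(ζ_p^c)`, `0 < c < p/2`, are `ℤ`-linearly independent (Milnor's conjecture for `p`):
`⇒` by `stub_cyclotomicIndependence` (an explained primitive combination is zero — for a prime `p`
every residue `0 < c < p/2` is a unit), `⇐` because the points of `μ_p ∩ ℍ⁺` are exactly the `ζ_p^c`,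
`0 < c < p/2`, so after grouping by the exponent an independent family admits only the zero relation,
whose formal combination is `0`. [cite: Milnor1982, Appendix] -/
theorem stub_cyclotomicPrimeSector_iff :
    ∀ (p : ℕ) [NeZero p], p.Prime →
      ((∀ (k : ℕ) (u : Fin k → ℂ) (n : Fin k → ℤ), (∀ i, u i ^ p = 1) → (∀ i, 0 < (u i).im) →
          ∑ i, (n i : ℝ) * blochWignerDilog (u i) = 0 →
            (∑ i, n i • FreeAbelianGroup.of (u i)) ∈ AddSubgroup.closure dilogRelators) ↔
        (∀ m : ZMod p → ℤ, (∀ c, m c ≠ 0 → 0 < c.val ∧ 2 * c.val < p) →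
          ∑ c : ZMod p, (m c : ℝ) *
              blochWignerDilog (Complex.exp (2 * Real.pi * Complex.I / p) ^ c.val) = 0 →
            ∀ c, m c = 0)) := by
  intro p _ hp
  classical
  set ζ : ℂ := Complex.exp (2 * Real.pi * Complex.I / p) with hζ
  have hprim : IsPrimitiveRoot ζ p := Complex.isPrimitiveRoot_exp p (NeZero.ne p)
  constructor
  · -- `⇒`: restrict the crux to the support family, then cyclotomic independence
    intro hL m hsupp hsum
    set S := {c : ZMod p // m c ≠ 0} with hS
    set k := Fintype.card S
    set e : S ≃ Fin k := Fintype.equivFin S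
    set z : Fin k → ℂ := fun i => ζ ^ ((e.symm i : ZMod p)).val with hz
    set n : Fin k → ℤ := fun i => m (e.symm i) with hn
    have hpow : ∀ i, z i ^ p = 1 := fun i => by
      simp only [hz]
      rw [← pow_mul, mul_comm, pow_mul, hprim.pow_eq_one, one_pow]
    have him : ∀ i, 0 < (z i).im := fun i =>
      zeta_pow_im_pos p (hsupp _ (e.symm i).2).1 (hsupp _ (e.symm i).2).2
    -- sums over the support family are sums over `ℤ/p`
    have hreindex : ∀ (G : Type) [AddCommMonoid G] (F : ZMod p → ℤ → G), (∀ c, F c 0 = 0) →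
        ∑ i, F (e.symm i) (n i) = ∑ c : ZMod p, F c (m c) := by
      intro G _ F hF
      rw [Fintype.sum_equiv e.symm (fun i => F (e.symm i) (n i)) (fun s : S => F s (m s))
          (fun i => rfl),
        ← Finset.sum_subtype (Finset.univ.filter fun c => m c ≠ 0) (by simp)
          (fun c => F c (m c))]
      exact Finset.sum_filter_of_ne fun c _ hc h0 => hc (by rw [h0, hF])
    have hval : ∑ i, (n i : ℝ) * blochWignerDilog (z i) = 0 := by
      have := hreindex ℝ (fun c t => (t : ℝ) * blochWignerDilog (ζ ^ c.val)) (fun c => by simp)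
      rw [this]
      exact hsum
    have hmem := hL k z n hpow him hval
    have hformal : (∑ i, n i • FreeAbelianGroup.of (z i)) =
        ∑ c : ZMod p, m c • FreeAbelianGroup.of (ζ ^ c.val) :=
      hreindex (FreeAbelianGroup ℂ) (fun c t => t • FreeAbelianGroup.of (ζ ^ c.val))
        (fun c => by simp)
    rw [hformal] at hmem
    haveI : Fact p.Prime := ⟨hp⟩
    refine stub_cyclotomicIndependence p m (fun c hc => ⟨?_, hsupp c hc⟩) hmem
    exact isUnit_iff_ne_zero.2 (ZMod.val_pos.1 (hsupp c hc).1)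
  · -- `⇐`: group the family by the exponent, then Milnor
    intro hM k u n hpow him hsum
    have hpt : ∀ i, ∃ c : ZMod p, 0 < c.val ∧ 2 * c.val < p ∧ u i = ζ ^ c.val := fun i =>
      exists_eq_zeta_pow p (hpow i) (him i)
    choose c hc using hpt
    have hu : ∀ i, ζ ^ (c i).val = u i := fun i => (hc i).2.2.symm
    -- the grouped coefficients
    obtain ⟨M, hMdef⟩ : ∃ M : ZMod p → ℤ,
        ∀ d, M d = ∑ i ∈ Finset.univ.filter (fun i => c i = d), n i := ⟨_, fun d => rfl⟩
    have hMsum : ∑ d : ZMod p, (M d : ℝ) * blochWignerDilog (ζ ^ d.val) = 0 := by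
      have h := sum_fiber_mul c n (fun d => blochWignerDilog (ζ ^ d.val))
      simp only [hu] at h
      simp only [hMdef]
      exact h.trans hsum
    have hMsupp : ∀ d, M d ≠ 0 → 0 < d.val ∧ 2 * d.val < p := by
      intro d hd
      rw [hMdef] at hd
      obtain ⟨i, hi, -⟩ := Finset.exists_ne_zero_of_sum_ne_zero hd
      rw [← (Finset.mem_filter.1 hi).2]
      exact ⟨(hc i).1, (hc i).2.1⟩
    have hM0 : ∀ d, M d = 0 := hM M hMsupp hMsum
    have hformal : (∑ i, n i • FreeAbelianGroup.of (u i)) =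
        ∑ d : ZMod p, M d • FreeAbelianGroup.of (ζ ^ d.val) := by
      have h := sum_fiber_zsmul c n (fun d => FreeAbelianGroup.of (ζ ^ d.val))
      simp only [hu] at h
      simp only [hMdef]
      exact h.symm
    rw [hformal, Finset.sum_eq_zero fun d _ => by rw [hM0 d, zero_smul]]
    exact zero_mem _

end Summit.KontsevichZagierPeriods.HyperbolicBloch.ZagierDilogarithmCyclotomic

end
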